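import Mathlib
import HarnessLib
import Literature.MathematicalPhysics.QuantumLattice.HubbardPairEnergyNondegenerate
import Summits.HubbardSuperconductivity.HubbardSuperconductivity.Theorems.WeakCouplingBCSKlCertTPrimePocketGaussMap
import Summits.HubbardSuperconductivity.HubbardSuperconductivity.Theorems.WeakCouplingBCSKlCertTPrimePairEnergy

/-!
# Route `WeakCouplingBCS` — certificate half of stmt-HubbardSuperconductivity-0158, item (N3)′ of «TPRIME-LINDHARD-HS» (pen (R475)(A)), file F2b:
# the pair energy along the Γ-centred `t′` chart is SECOND-ORDER NONDEGENERATE in the three directions `e_θ`, `e_φ`, `e_θ + e_φ`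

Cell `gate-hubbard-kl`, seat p4 (g24); zero kit; no definitions.  The `t′`-twin of `Literature…pairE_nondegenerate` for the pair energy
`G = kltpPairE tp μ p` of `…KlCertTPrimePairEnergy` on the Γ-window `|t′| < 1/2`, `−4 − 4t′ < μ < 4t′`, under TWO HYPOTHESES discharged per cell:

* `hN` — STRICT CONVEXITY: `0 < curvNum t′ (x θ) (y θ)` along the chart (for the `(⅛, −3/10)` cell: margin-1's brick (G1) `kltp_curvNum_pos_p03`,
  from `KlTPrimeConvexity.Mside_curvNum_neg` through the particle–hole map);
* `hlev` — LEVEL POINTS ARE CHART POINTS MOD `2π`: every real solution `(X, Y)` of `ε_{t′}(X, Y) = μ` has the cosines and sines of some chart point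
  `γ(ψ)` (margin-1's brick (G2) `kltp_exists_angle_of_level`, from `kltp_fermiCurve_subset_image_polar`).

**Theorem** (`kltpPairE_nondegenerate`).  Then for all `p, θ, φ` the six numbers `G, ∂_θG, ∂_φG, ∂²_θG, ∂²_φG, (∂_θ+∂_φ)²G` are not all zero.
*Proof* (as at `t′ = 0`).  `G = 0` puts the pair momentum on the level set, so its trigonometric data are those of `γ(ψ)` (`hlev`); `∂_θG = 0`
makes `∇ε(γψ)` and `∇ε(γθ)` both orthogonal to `γ′(θ) ≠ 0`, hence parallel, so `θ = ψ + jπ` by Gauss-map injectivity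
(`kltp_exists_eq_add_int_mul_pi_of_cross_eq_zero`, needs `hN`), likewise `φ = ψ + j′π`; by the half-turn symmetry the frame at `θ`, `φ` is `e₁`,
`e₂ ∈ {±1}` times the frame at `ψ`, and with `Q = kltpHessForm(ψ) > 0` and `Q + ∇ε·γ″ = 0` one finds `∂²_θG = Q(1 − e₁)`, `∂²_φG = Q(1 − e₂)`,
`∂_θ∂_φG = e₁e₂Q` (idea-2 g17 r17 cross-check: families (0,0,Q,2Q), (0,2Q,−Q,0), (2Q,2Q,Q,6Q) agree); vanishing of the pure second derivatives
forces `e₁ = e₂ = 1` and then `(∂_θ+∂_φ)²G = 2Q ≠ 0`.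

Honest framing: nothing here asserts `hN`/`hlev` at any cell, (N3)′, an HS row, a margin, `K₃`, `U₀`, the window or superconductivity; a
Kohn–Luttinger `O(U²)` channel statement is not ODLRO; nothing here proves superconductivity in the Hubbard model.
References: G. Benfatto, A. Giuliani, V. Mastropietro, Ann. Henri Poincaré 7 (2006) 809, §1; E. M. Stein, *Harmonic Analysis* (1993), Ch. VIII §1.
-/

noncomputable section

-- the tree's namespace `Summit.<Summit>.<Problem>.Theorems` repeats the summit name by design (D-0017)
set_option linter.dupNamespace false

namespace Summit.HubbardSuperconductivity.HubbardSuperconductivity.Theorems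

open Real Set Filter Literature.MathematicalPhysics.QuantumLattice KlTPrimeConvexity
open scoped Topology

section Window

variable {tp μ : ℝ} (htp : |tp| < 1 / 2) (hμ₁ : -4 - 4 * tp < μ) (hμ₂ : μ < 4 * tp)
include htp hμ₁ hμ₂

/-- **Second-order nondegeneracy of the `t′` pair energy in the three directions `e_θ`, `e_φ`, `e_θ + e_φ`** on a strictly convex
Γ-pocket whose chart exhausts the level set modulo `2π`: for all `p, θ, φ`, the numbers `G`, `∂_θG`, `∂_φG`, `∂²_θG`, `∂²_φG`, `(∂_θ+∂_φ)²G`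
at `(θ, φ)` are not all zero. [cite: BenfattoGiulianiMastropietro2006, §1 (1.5)] -/
theorem kltpPairE_nondegenerate (hN : ∀ θ : ℝ, 0 < curvNum tp (kltpX tp μ θ) (kltpY tp μ θ))
    (hlev : ∀ X Y : ℝ, -2 * 1 * (Real.cos X + Real.cos Y) - 4 * tp * Real.cos X * Real.cos Y = μ →
      ∃ ψ : ℝ, Real.cos X = Real.cos (kltpPolar tp μ ψ 0) ∧ Real.sin X = Real.sin (kltpPolar tp μ ψ 0) ∧
        Real.cos Y = Real.cos (kltpPolar tp μ ψ 1) ∧ Real.sin Y = Real.sin (kltpPolar tp μ ψ 1))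
    (p : ℝ × ℝ) (θ φ : ℝ) :
    ¬(kltpPairE tp μ p θ φ = 0 ∧ kltpPairE₁ tp μ p θ φ = 0 ∧ kltpPairE₂ tp μ p θ φ = 0 ∧
      kltpPairE₁₁ tp μ p θ φ = 0 ∧ kltpPairE₂₂ tp μ p θ φ = 0 ∧ kltpPairEdd tp μ p θ φ = 0) := by
  rintro ⟨h0, h1, h2, h11, h22, hdd⟩
  set X : ℝ := kltpPairKX tp μ p θ φ with hXdef
  set Y : ℝ := kltpPairKY tp μ p θ φ with hYdef
  -- `G = 0`: the pair momentum is on the level set, hence has the trigonometric data of a chart point `γ(ψ)`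
  have hlevel : -2 * 1 * (Real.cos X + Real.cos Y) - 4 * tp * Real.cos X * Real.cos Y = μ := by
    have h0' := h0
    simp only [kltpPairE] at h0'
    linarith
  obtain ⟨ψ, hcX, hsX, hcY, hsY⟩ := hlev X Y hlevel
  rw [kltpPolar_apply_zero'] at hcX hsX
  rw [kltpPolar_apply_one'] at hcY hsY
  -- the coefficient functions at `(X, Y)` are those at `(x ψ, y ψ)`
  have edx : dx tp X Y = dx tp (kltpX tp μ ψ) (kltpY tp μ ψ) := by simp only [dx, hsX, hcY]
  have edy : dy tp X Y = dy tp (kltpX tp μ ψ) (kltpY tp μ ψ) := by simp only [dy, hsY, hcX]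
  have edxx : dxx tp X Y = dxx tp (kltpX tp μ ψ) (kltpY tp μ ψ) := by simp only [dxx, hcX, hcY]
  have edyy : dyy tp X Y = dyy tp (kltpX tp μ ψ) (kltpY tp μ ψ) := by simp only [dyy, hcY, hcX]
  have edxy : dxy tp X Y = dxy tp (kltpX tp μ ψ) (kltpY tp μ ψ) := by simp only [dxy, hsX, hsY]
  -- `∂_θG = 0` and `∂_φG = 0`: the gradients at `P` and at `γ(θ)`, `γ(φ)` are parallel
  have hTθ := kltp_tangency htp hμ₁ hμ₂ θ
  have hTφ := kltp_tangency htp hμ₁ hμ₂ φ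
  have h1' : dx tp (kltpX tp μ ψ) (kltpY tp μ ψ) * kltpVX tp μ θ + dy tp (kltpX tp μ ψ) (kltpY tp μ ψ) * kltpVY tp μ θ = 0 := by
    have h := h1
    simp only [kltpPairE₁] at h
    rwa [← hXdef, ← hYdef, edx, edy] at h
  have h2' : dx tp (kltpX tp μ ψ) (kltpY tp μ ψ) * kltpVX tp μ φ + dy tp (kltpX tp μ ψ) (kltpY tp μ ψ) * kltpVY tp μ φ = 0 := by
    have h := h2
    simp only [kltpPairE₂] at h
    rwa [← hXdef, ← hYdef, edx, edy] at h
  have hcrossθ : dx tp (kltpX tp μ θ) (kltpY tp μ θ) * dy tp (kltpX tp μ ψ) (kltpY tp μ ψ) -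
      dy tp (kltpX tp μ θ) (kltpY tp μ θ) * dx tp (kltpX tp μ ψ) (kltpY tp μ ψ) = 0 :=
    cross_eq_zero_of_orthogonal (kltpVX_sq_add_kltpVY_sq_pos htp hμ₁ hμ₂ θ).ne' h1' hTθ
  have hcrossφ : dx tp (kltpX tp μ φ) (kltpY tp μ φ) * dy tp (kltpX tp μ ψ) (kltpY tp μ ψ) -
      dy tp (kltpX tp μ φ) (kltpY tp μ φ) * dx tp (kltpX tp μ ψ) (kltpY tp μ ψ) = 0 :=
    cross_eq_zero_of_orthogonal (kltpVX_sq_add_kltpVY_sq_pos htp hμ₁ hμ₂ φ).ne' h2' hTφ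
  obtain ⟨j₁, hj₁⟩ := kltp_exists_eq_add_int_mul_pi_of_cross_eq_zero htp hμ₁ hμ₂ hN hcrossθ
  obtain ⟨j₂, hj₂⟩ := kltp_exists_eq_add_int_mul_pi_of_cross_eq_zero htp hμ₁ hμ₂ hN hcrossφ
  -- `θ = ψ + (-j₁)π`, `φ = ψ + (-j₂)π`
  have hθ : θ = ψ + (-j₁ : ℤ) * π := by push_cast; linarith
  have hφ : φ = ψ + (-j₂ : ℤ) * π := by push_cast; linarith
  obtain ⟨e₁, he₁, -, -, hvx₁, hvy₁, hax₁, hay₁⟩ := kltpFrame_add_int_mul_pi htp hμ₁ hμ₂ ψ (-j₁)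
  obtain ⟨e₂, he₂, -, -, hvx₂, hvy₂, hax₂, hay₂⟩ := kltpFrame_add_int_mul_pi htp hμ₁ hμ₂ ψ (-j₂)
  rw [← hθ] at hvx₁ hvy₁ hax₁ hay₁
  rw [← hφ] at hvx₂ hvy₂ hax₂ hay₂
  -- curvature data at `ψ`
  have hQ := kltpHessForm_pos htp hμ₁ hμ₂ hN ψ
  have hT := kltp_hessForm_add_grad_dot_acc htp hμ₁ hμ₂ ψ
  simp only [kltpHessForm] at hQ hT
  have hsq₁ : e₁ ^ 2 = 1 := by rcases he₁ with h | h <;> simp [h]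
  have hsq₂ : e₂ ^ 2 = 1 := by rcases he₂ with h | h <;> simp [h]
  -- the three second derivatives in terms of `Q = ε_xx x′² + 2ε_xy x′y′ + ε_yy y′²` at `ψ`, `e₁`, `e₂`
  set Q : ℝ := dxx tp (kltpX tp μ ψ) (kltpY tp μ ψ) * kltpVX tp μ ψ ^ 2 +
      2 * dxy tp (kltpX tp μ ψ) (kltpY tp μ ψ) * kltpVX tp μ ψ * kltpVY tp μ ψ +
      dyy tp (kltpX tp μ ψ) (kltpY tp μ ψ) * kltpVY tp μ ψ ^ 2 with hQdef
  have e11 : kltpPairE₁₁ tp μ p θ φ = Q * (1 - e₁) := by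
    have h : kltpPairE₁₁ tp μ p θ φ = dxx tp X Y * kltpVX tp μ θ ^ 2 + 2 * dxy tp X Y * kltpVX tp μ θ * kltpVY tp μ θ +
        dyy tp X Y * kltpVY tp μ θ ^ 2 + (dx tp X Y * kltpAX tp μ θ + dy tp X Y * kltpAY tp μ θ) := rfl
    rw [h, edx, edy, edxx, edyy, edxy, hvx₁, hvy₁, hax₁, hay₁, hQdef]
    linear_combination e₁ * hT + (dxx tp (kltpX tp μ ψ) (kltpY tp μ ψ) * kltpVX tp μ ψ ^ 2 +
      2 * dxy tp (kltpX tp μ ψ) (kltpY tp μ ψ) * kltpVX tp μ ψ * kltpVY tp μ ψ +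
      dyy tp (kltpX tp μ ψ) (kltpY tp μ ψ) * kltpVY tp μ ψ ^ 2) * hsq₁
  have e22 : kltpPairE₂₂ tp μ p θ φ = Q * (1 - e₂) := by
    have h : kltpPairE₂₂ tp μ p θ φ = dxx tp X Y * kltpVX tp μ φ ^ 2 + 2 * dxy tp X Y * kltpVX tp μ φ * kltpVY tp μ φ +
        dyy tp X Y * kltpVY tp μ φ ^ 2 + (dx tp X Y * kltpAX tp μ φ + dy tp X Y * kltpAY tp μ φ) := rfl
    rw [h, edx, edy, edxx, edyy, edxy, hvx₂, hvy₂, hax₂, hay₂, hQdef]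
    linear_combination e₂ * hT + (dxx tp (kltpX tp μ ψ) (kltpY tp μ ψ) * kltpVX tp μ ψ ^ 2 +
      2 * dxy tp (kltpX tp μ ψ) (kltpY tp μ ψ) * kltpVX tp μ ψ * kltpVY tp μ ψ +
      dyy tp (kltpX tp μ ψ) (kltpY tp μ ψ) * kltpVY tp μ ψ ^ 2) * hsq₂
  have e12 : kltpPairE₁₂ tp μ p θ φ = Q * (e₁ * e₂) := by
    have h : kltpPairE₁₂ tp μ p θ φ = dxx tp X Y * kltpVX tp μ θ * kltpVX tp μ φ +
        dxy tp X Y * (kltpVX tp μ θ * kltpVY tp μ φ + kltpVX tp μ φ * kltpVY tp μ θ) +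
        dyy tp X Y * kltpVY tp μ θ * kltpVY tp μ φ := rfl
    rw [h, edxx, edyy, edxy, hvx₁, hvy₁, hvx₂, hvy₂, hQdef]
    ring
  have hE₁ : e₁ = 1 := by
    rcases he₁ with h | h
    · exact h
    · exfalso
      rw [e11, h] at h11
      have h4 : Q * (1 - (-1 : ℝ)) = 2 * Q := by ring
      rw [h4] at h11
      linarith
  have hE₂ : e₂ = 1 := by
    rcases he₂ with h | h
    · exact h
    · exfalso
      rw [e22, h] at h22
      have h4 : Q * (1 - (-1 : ℝ)) = 2 * Q := by ring
      rw [h4] at h22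
      linarith
  have : kltpPairEdd tp μ p θ φ = 2 * Q := by
    rw [kltpPairEdd, e11, e12, e22, hE₁, hE₂]; ring
  rw [this] at hdd
  linarith

end Window

end Summit.HubbardSuperconductivity.HubbardSuperconductivity.Theorems

end
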